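import Literature.MathematicalPhysics.QuantumManyBody.BogoliubovSpectrumGP
import HarnessLib

/-!
# The Bogoliubov dispersion `ε(p) = √(|p|⁴ + 16π𝔞|p|²)` in the Gross–Pitaevskii regime:
# elementary bounds and the two lowest levels of `𝒟 = Σ_p ε_p a_p† a_p`

Topic `Literature/MathematicalPhysics/QuantumManyBody`, namespace `BoseGas`; helper file for the
provefact `Literature.MathematicalPhysics.QuantumManyBody.BoseGas.BoccatoEtAl2019_firstGap_GP`
(equivalently `…BoccatoEtAl2019Acta_firstExcitation`, cf. `BogoliubovSpectrumGPProofs.lean`):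
[Boccato–Brennecke–Cenatiempo–Schlein 2019, §6]. The comparison operator of the min–max argument
is the diagonal quadratic operator `𝒟 = Σ_{p ∈ Λ*₊} ε_p a_p† a_p` ((6.1)), `Λ*₊ = 2πℤ³ ∖ {0}`,
`ε_p = (|p|⁴ + 16π𝔞₀p²)^{1/2}` = `bogoliubovDispersionGP 𝔞₀ |p|`; its eigenvalues are
`ν = Σ_p n_p ε_p` over occupation configurations `(n_p)` ((6.3)–(6.4)), so that `ν₁ = 0` (vacuum)
and every other level is `≥ ε_{2π}` = `ν₂` (one phonon at the lowest momentum `|p| = 2π`). This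
file proves these elementary facts, which are the level data (`k₀` = vacuum, `m₂ = ε_{2π}`) fed to
the abstract Ky Fan bound `Literature.Analysis.InnerProduct.kyFan_two_le_of_hasSum_norm_inner_sq`:

* `bogoliubovDispersionGP_nonneg`, `bogoliubovDispersionGP_neg`, `bogoliubovDispersionGP_zero_right`;
* `sq_le_bogoliubovDispersionGP` (`p² ≤ ε_p`, the bound "`ε_p ≥ p²`" used in the proof of
  Lemma 6.1) and `bogoliubovDispersionGP_le` (`ε_p ≤ p² + 8π𝔞`), for `𝔞 ≥ 0`;
* `bogoliubovDispersionGP_mono` (monotone in `|p|`), `bogoliubovDispersionGP_pos`;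
* `bogoliubovDispersionGP_lowest` (`ε(2π/L) ≤ ε(2π|n|/L)` for `n ≠ 0`, `L > 0`: the lowest
  non-zero momentum of the torus of side `L` minimises the dispersion);
* `bogoliubovLevel` is NOT defined: levels are written inline as the finitely supported sums
  `Σ_{n ∈ d.support} d(n) ε(2π|n|/L)` over an occupation configuration `d : ℤ³ →₀ ℕ` without zero
  mode, and `bogoliubovDispersionGP_le_level` proves `ε(2π/L) ≤ Σ_n d(n) ε(2π|n|/L)` for `d ≠ 0`
  (`level_zero`: the vacuum level is `0`).

No definitions, no named facts.

## References

* C. Boccato, C. Brennecke, S. Cenatiempo, B. Schlein, *Bogoliubov theory in the Gross–Pitaevskii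
  limit*, Acta Math. 222 (2019) 219–335, §6: (6.1) (the operator `𝒟`), the eigenvalue formula
  `ν_j = Σ_p n_p^{(j)} ε_p` and the bound `ε_p ≥ p²` (proof of Lemma 6.1). [BoccatoEtAl2019Acta]
-/

noncomputable section

namespace Literature.MathematicalPhysics.QuantumManyBody.BoseGas

open Finset

/-! ### Pointwise bounds on the dispersion -/

/-- `ε(p) ≥ 0`. [cite: BoccatoEtAl2019Acta, §6 (6.1)] -/
theorem bogoliubovDispersionGP_nonneg (a p : ℝ) : 0 ≤ bogoliubovDispersionGP a p :=
  Real.sqrt_nonneg _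

/-- The dispersion is even in `p` (it depends on `|p|` only). [cite: BoccatoEtAl2019Acta, §6 (6.1)] -/
theorem bogoliubovDispersionGP_neg (a p : ℝ) :
    bogoliubovDispersionGP a (-p) = bogoliubovDispersionGP a p := by
  simp [bogoliubovDispersionGP, neg_pow, show ((-1 : ℝ) ^ 4) = 1 by norm_num]

/-- `ε(0) = 0`. [cite: BoccatoEtAl2019Acta, §6 (6.1)] -/
theorem bogoliubovDispersionGP_zero_right (a : ℝ) : bogoliubovDispersionGP a 0 = 0 := by
  simp [bogoliubovDispersionGP]

/-- **`ε_p ≥ p²`** for a non-negative scattering length (the bound used in the proof of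
Lemma 6.1: `𝒟 ≥ 𝒦` termwise). [cite: BoccatoEtAl2019Acta, Lemma 6.1 (proof)] -/
theorem sq_le_bogoliubovDispersionGP {a : ℝ} (ha : 0 ≤ a) (p : ℝ) :
    p ^ 2 ≤ bogoliubovDispersionGP a p := by
  have : 0 ≤ 16 * Real.pi * a * p ^ 2 := by positivity
  rw [bogoliubovDispersionGP, Real.le_sqrt (sq_nonneg p) (by positivity)]
  nlinarith

/-- **`ε_p ≤ p² + 8π𝔞`** for `𝔞 ≥ 0` (since `(p² + 8π𝔞)² = p⁴ + 16π𝔞p² + (8π𝔞)²`).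
[cite: BoccatoEtAl2019Acta, §6 (6.1)] -/
theorem bogoliubovDispersionGP_le {a : ℝ} (ha : 0 ≤ a) (p : ℝ) :
    bogoliubovDispersionGP a p ≤ p ^ 2 + 8 * Real.pi * a := by
  rw [bogoliubovDispersionGP, Real.sqrt_le_left (by positivity)]
  have : 0 ≤ (8 * Real.pi * a) ^ 2 := sq_nonneg _
  nlinarith

/-- The dispersion is monotone in `|p|`: `0 ≤ p ≤ q → ε(p) ≤ ε(q)` (`𝔞 ≥ 0`).
[cite: BoccatoEtAl2019Acta, §6 (6.1)] -/
theorem bogoliubovDispersionGP_mono {a : ℝ} (ha : 0 ≤ a) {p q : ℝ} (hp : 0 ≤ p) (hpq : p ≤ q) :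
    bogoliubovDispersionGP a p ≤ bogoliubovDispersionGP a q := by
  unfold bogoliubovDispersionGP
  refine Real.sqrt_le_sqrt ?_
  have h2 : p ^ 2 ≤ q ^ 2 := pow_le_pow_left₀ hp hpq 2
  have h4 : p ^ 4 ≤ q ^ 4 := pow_le_pow_left₀ hp hpq 4
  have : 0 ≤ 16 * Real.pi * a := by positivity
  nlinarith

/-- `ε(p) > 0` for `p ≠ 0` (`𝔞 ≥ 0`). [cite: BoccatoEtAl2019Acta, §6 (6.1)] -/
theorem bogoliubovDispersionGP_pos {a : ℝ} (ha : 0 ≤ a) {p : ℝ} (hp : p ≠ 0) :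
    0 < bogoliubovDispersionGP a p :=
  lt_of_lt_of_le (by positivity) (sq_le_bogoliubovDispersionGP ha p)

/-! ### The lowest non-zero momentum of the torus -/

/-- **The lowest momentum minimises the dispersion**: on the torus of side `L > 0` the momenta are
`p = 2πn/L`, `n ∈ ℤ³`, `|p| = 2π|n|/L`, and for every `n ≠ 0`, `ε(2π/L) ≤ ε(2π|n|/L)` (`𝔞 ≥ 0`).
For `L = 1` this is `ε_{2π} ≤ ε_p` for all `p ∈ Λ*₊`, i.e. `ν₂ = ε_{2π}`.
[cite: BoccatoEtAl2019Acta, Thm 1.1 and §6 (ν₂ = ε at |p| = 2π)] -/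
theorem bogoliubovDispersionGP_lowest {a L : ℝ} (ha : 0 ≤ a) (hL : 0 < L) {n : Fin 3 → ℤ}
    (hn : n ≠ 0) :
    bogoliubovDispersionGP a (2 * Real.pi / L) ≤
      bogoliubovDispersionGP a (2 * Real.pi * Real.sqrt (∑ j, (n j : ℝ) ^ 2) / L) := by
  have hs : 0 ≤ ∑ j, (n j : ℝ) ^ 2 := Finset.sum_nonneg fun j _ => sq_nonneg _
  refine bogoliubovDispersionGP_mono ha (by positivity) ?_
  rw [div_le_div_iff_of_pos_right hL]
  -- `|n|² ≥ 1` for `n ≠ 0` (as in `PeriodicBoseGasKineticMultiplierProofs.one_le_sum_sq_of_ne_zero`)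
  have hsum : (1 : ℝ) ≤ ∑ j, (n j : ℝ) ^ 2 := by
    obtain ⟨j, hj⟩ : ∃ j, n j ≠ 0 := by
      by_contra h
      exact hn (funext fun j => not_not.1 fun hj => h ⟨j, hj⟩)
    have hj1 : (1 : ℝ) ≤ (n j : ℝ) ^ 2 := by
      have h1 : (1 : ℤ) ≤ (n j) ^ 2 := by
        have := Int.one_le_abs hj
        nlinarith [sq_abs (n j), abs_nonneg (n j)]
      exact_mod_cast h1
    exact hj1.trans (Finset.single_le_sum (fun i _ => sq_nonneg ((n i : ℝ))) (Finset.mem_univ j))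
  have h1 : (1 : ℝ) ≤ Real.sqrt (∑ j, (n j : ℝ) ^ 2) := by
    rw [Real.le_sqrt zero_le_one hs, one_pow]
    exact hsum
  have h2 : 0 ≤ 2 * Real.pi := by positivity
  nlinarith

/-! ### Levels of the diagonal operator `𝒟` -/

/-- **Every non-vacuum level of `𝒟` is at least `ε(2π/L)`.** For an occupation configuration
`d : ℤ³ →₀ ℕ` with no zero-momentum particle (`d 0 = 0`, the excitation Fock space `𝓕₊`) and
`d ≠ 0`, the `𝒟`-eigenvalue `ν(d) = Σ_n d(n) ε(2π|n|/L)` satisfies `ε(2π/L) ≤ ν(d)`: some mode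
`n ≠ 0` is occupied, `d(n) ≥ 1`, and `ε(2π|n|/L) ≥ ε(2π/L)`, all other terms being `≥ 0`.
With the vacuum level `ν(0) = 0` (`level_zero`) this is the input "`ν₁ = 0`, `ν₂ = ε_{2π}`, all
further levels `≥ ν₂`" of Ky Fan's bound. [cite: BoccatoEtAl2019Acta, §6 (ν_j = Σ n_p ε_p)] -/
theorem bogoliubovDispersionGP_le_level {a L : ℝ} (ha : 0 ≤ a) (hL : 0 < L)
    {d : (Fin 3 → ℤ) →₀ ℕ} (hd0 : d 0 = 0) (hd : d ≠ 0) :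
    bogoliubovDispersionGP a (2 * Real.pi / L) ≤
      ∑ n ∈ d.support, (d n : ℝ) *
        bogoliubovDispersionGP a (2 * Real.pi * Real.sqrt (∑ j, (n j : ℝ) ^ 2) / L) := by
  obtain ⟨n, hn⟩ : d.support.Nonempty :=
    Finset.nonempty_iff_ne_empty.2 (by rwa [Ne, Finsupp.support_eq_empty])
  have hdn : d n ≠ 0 := Finsupp.mem_support_iff.1 hn
  have hn0 : n ≠ 0 := fun h => hdn (h ▸ hd0)
  have h1 : (1 : ℝ) ≤ d n := by exact_mod_cast Nat.one_le_iff_ne_zero.2 hdn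
  calc bogoliubovDispersionGP a (2 * Real.pi / L)
      ≤ (d n : ℝ) * bogoliubovDispersionGP a (2 * Real.pi * Real.sqrt (∑ j, (n j : ℝ) ^ 2) / L) := by
        have hε := bogoliubovDispersionGP_lowest ha hL hn0
        have hε0 := bogoliubovDispersionGP_nonneg a (2 * Real.pi / L)
        nlinarith
    _ ≤ ∑ m ∈ d.support, (d m : ℝ) *
          bogoliubovDispersionGP a (2 * Real.pi * Real.sqrt (∑ j, (m j : ℝ) ^ 2) / L) :=
        Finset.single_le_sum (f := fun m => (d m : ℝ) *
            bogoliubovDispersionGP a (2 * Real.pi * Real.sqrt (∑ j, (m j : ℝ) ^ 2) / L))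
          (fun m _ => mul_nonneg (Nat.cast_nonneg _) (bogoliubovDispersionGP_nonneg _ _)) hn

/-- The vacuum level of `𝒟` is `0` (`ν₁ = 0`). [cite: BoccatoEtAl2019Acta, §6 (ν₁ = 0)] -/
theorem level_zero (a L : ℝ) :
    ∑ n ∈ (0 : (Fin 3 → ℤ) →₀ ℕ).support, ((0 : (Fin 3 → ℤ) →₀ ℕ) n : ℝ) *
        bogoliubovDispersionGP a (2 * Real.pi * Real.sqrt (∑ j, (n j : ℝ) ^ 2) / L) = 0 := by
  simp

/-- Levels are non-negative. [cite: BoccatoEtAl2019Acta, §6 (6.1)] -/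
theorem level_nonneg (a L : ℝ) (d : (Fin 3 → ℤ) →₀ ℕ) :
    0 ≤ ∑ n ∈ d.support, (d n : ℝ) *
        bogoliubovDispersionGP a (2 * Real.pi * Real.sqrt (∑ j, (n j : ℝ) ^ 2) / L) :=
  Finset.sum_nonneg fun _ _ => mul_nonneg (Nat.cast_nonneg _) (bogoliubovDispersionGP_nonneg a _)

end Literature.MathematicalPhysics.QuantumManyBody.BoseGas

end
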